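import Mathlib
import Literature.MathematicalPhysics.KineticTheory.InfiniteChainObservables
import HarnessLib

/-!
# Cesàro upgrade, helper 3: Cesàro averages over shifts, tightness, a shift-invariant cluster point

Support file for item `stmt-AtomisticToContinuum-13981` (`ParityLiouvilleSeed.CesaroUpgrade`).

For a probability measure `ν` on `ChainConfig = ℤ → ℝ × ℝ` the Cesàro averages over the spatial
shift are the probability measures
`ν_n = (n+1)⁻¹ ∑_{k=0}^{n} ν ∘ (τ^k)⁻¹` (written out as
`((n : ℝ≥0∞) + 1)⁻¹ • ∑ k ∈ Finset.range (n + 1), ν.map (shift^[k])`, no new definition).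
This file proves:

* `integral_cesaro` — `∫ f dν_n = (n+1)⁻¹ ∑_k ∫ f ∘ τ^k dν` (with integrability);
* `isTimeInvariant_cesaro` — time invariance (generator form) passes to `ν_n`;
* `site_moment_cesaro` — SITE-UNIFORM moment bounds pass to `ν_n` with the same constant;
* `isTightMeasureSet_of_site_sq_moment` — a family of probability measures with site-uniform
  second moments is tight (boxes `∏_x B(0, r_x)` are compact by Tychonoff; Chebyshev per site);
* `exists_cesaro_clusterPt` — by PROKHOROV (Mathlib `isCompact_closure_of_isTightMeasureSet`)
  the sequence `(ν_n)` has a weak cluster point `ν̄` along an ultrafilter finer than `atTop`,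
  and `ν̄` is SHIFT INVARIANT (`‖ν_n ∘ τ⁻¹ - ν_n‖ ≤ 2/(n+1)` tested against bounded continuous
  functions, uniqueness of weak limits, `FiniteMeasure.ext_of_forall_integral_eq`).
-/

noncomputable section

namespace Summit.AtomisticToContinuum.FouriersLaw.Theorems.CesaroUpgrade

open MeasureTheory Filter Topology Set BoundedContinuousFunction
open scoped ENNReal
open Literature.MathematicalPhysics.KineticTheory.HeatConduction

/-! ### Iterated shifts -/

/-- Iterated shifts are measurable. [folklore] -/
@[fun_prop]
theorem measurable_shift_iterate (k : ℕ) : Measurable (shift^[k]) :=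
  shift_measurable.iterate k

/-- Iterated shifts are continuous. [folklore] -/
@[fun_prop]
theorem continuous_shift_iterate (k : ℕ) : Continuous (shift^[k]) :=
  (continuous_pi fun _ => continuous_apply _ : Continuous shift).iterate k

/-- `(τ^k σ)_x = σ_{x+k}`. [folklore] -/
theorem shift_iterate_apply (k : ℕ) (σ : ChainConfig) (x : ℤ) : (shift^[k]) σ x = σ (x + k) := by
  induction k generalizing x with
  | zero => simp
  | succ k ih =>
    rw [Function.iterate_succ_apply', shift, ih]
    congr 1; push_cast; ring

/-- Time invariance passes to every shifted measure `ν ∘ (τ^k)⁻¹`. [folklore] -/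
theorem isTimeInvariant_map_shift_iterate {P : OscillatorChain} {ν : Measure ChainConfig}
    (h : IsTimeInvariant P ν) (k : ℕ) : IsTimeInvariant P (ν.map (shift^[k])) := by
  induction k with
  | zero => simpa using h
  | succ k ih =>
    have : ν.map (shift^[k + 1]) = (ν.map (shift^[k])).map shift := by
      rw [Function.iterate_succ', Measure.map_map shift_measurable (measurable_shift_iterate k)]
    rw [this]
    exact ih.map_shift

/-! ### The Cesàro averages -/

/-- The Cesàro average is a probability measure. [folklore] -/
theorem isProbabilityMeasure_cesaro (ν : Measure ChainConfig) [IsProbabilityMeasure ν] (n : ℕ) :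
    IsProbabilityMeasure
      (((n : ℝ≥0∞) + 1)⁻¹ • ∑ k ∈ Finset.range (n + 1), ν.map (shift^[k])) := by
  constructor
  rw [Measure.smul_apply, Measure.finsetSum_apply]
  have : ∀ k ∈ Finset.range (n + 1), (ν.map (shift^[k])) univ = 1 := fun k _ => by
    rw [Measure.map_apply (measurable_shift_iterate k) MeasurableSet.univ, preimage_univ,
      measure_univ]
  rw [Finset.sum_congr rfl this, Finset.sum_const, Finset.card_range, smul_eq_mul,
    nsmul_eq_mul, mul_one]
  push_cast
  exact ENNReal.inv_mul_cancel (by positivity) (by simp)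

/-- **Integration against the Cesàro average**: `∫ f dν_n = (n+1)⁻¹ ∑_{k ≤ n} ∫ f ∘ τ^k dν`, for a
measurable `f` with every `f ∘ τ^k` integrable. [folklore] -/
theorem integral_cesaro {ν : Measure ChainConfig} [IsProbabilityMeasure ν] (n : ℕ)
    {f : ChainConfig → ℝ} (hf : Measurable f) (hint : ∀ k : ℕ, Integrable (f ∘ shift^[k]) ν) :
    Integrable f (((n : ℝ≥0∞) + 1)⁻¹ • ∑ k ∈ Finset.range (n + 1), ν.map (shift^[k])) ∧
      ∫ σ, f σ ∂(((n : ℝ≥0∞) + 1)⁻¹ • ∑ k ∈ Finset.range (n + 1), ν.map (shift^[k])) =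
        ((n : ℝ) + 1)⁻¹ * ∑ k ∈ Finset.range (n + 1), ∫ σ, f ((shift^[k]) σ) ∂ν := by
  have hk : ∀ k : ℕ, Integrable f (ν.map (shift^[k])) := fun k =>
    (integrable_map_measure hf.aestronglyMeasurable (measurable_shift_iterate k).aemeasurable).mpr
      (hint k)
  have hsum : Integrable f (∑ k ∈ Finset.range (n + 1), ν.map (shift^[k])) :=
    integrable_finsetSum_measure.mpr fun k _ => hk k
  have hne : ((n : ℝ≥0∞) + 1)⁻¹ ≠ ⊤ := ENNReal.inv_ne_top.mpr (by positivity)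
  refine ⟨hsum.smul_measure hne, ?_⟩
  rw [integral_smul_measure, integral_finsetSum_measure fun k _ => hk k]
  have htoReal : (((n : ℝ≥0∞) + 1)⁻¹).toReal = ((n : ℝ) + 1)⁻¹ := by
    rw [ENNReal.toReal_inv]; norm_cast
  rw [htoReal, smul_eq_mul]
  congr 1
  refine Finset.sum_congr rfl fun k _ => ?_
  exact integral_map (measurable_shift_iterate k).aemeasurable hf.aestronglyMeasurable

/-- Averages of constants: if every `∫ f ∘ τ^k dν = I` then `∫ f dν_n = I`. [folklore] -/
theorem integral_cesaro_eq_of_forall_eq {ν : Measure ChainConfig} [IsProbabilityMeasure ν] (n : ℕ)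
    {f : ChainConfig → ℝ} (hf : Measurable f) (hint : ∀ k : ℕ, Integrable (f ∘ shift^[k]) ν)
    {I : ℝ} (hI : ∀ k : ℕ, ∫ σ, f ((shift^[k]) σ) ∂ν = I) :
    ∫ σ, f σ ∂(((n : ℝ≥0∞) + 1)⁻¹ • ∑ k ∈ Finset.range (n + 1), ν.map (shift^[k])) = I := by
  rw [(integral_cesaro n hf hint).2, Finset.sum_congr rfl fun k _ => hI k, Finset.sum_const,
    Finset.card_range, nsmul_eq_mul]
  push_cast
  field_simp

/-- **Time invariance passes to the Cesàro averages.** [folklore] -/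
theorem isTimeInvariant_cesaro {P : OscillatorChain} {ν : Measure ChainConfig} [IsProbabilityMeasure ν]
    (h : IsTimeInvariant P ν) (n : ℕ) :
    IsTimeInvariant P (((n : ℝ≥0∞) + 1)⁻¹ • ∑ k ∈ Finset.range (n + 1), ν.map (shift^[k])) := by
  intro f hf
  have hk : ∀ k : ℕ, Integrable (liouvilleZ P f) (ν.map (shift^[k])) ∧
      ∫ σ, liouvilleZ P f σ ∂(ν.map (shift^[k])) = 0 := fun k =>
    isTimeInvariant_map_shift_iterate h k f hf
  have hsum : Integrable (liouvilleZ P f) (∑ k ∈ Finset.range (n + 1), ν.map (shift^[k])) :=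
    integrable_finsetSum_measure.mpr fun k _ => (hk k).1
  have hne : ((n : ℝ≥0∞) + 1)⁻¹ ≠ ⊤ := ENNReal.inv_ne_top.mpr (by positivity)
  refine ⟨hsum.smul_measure hne, ?_⟩
  rw [integral_smul_measure, integral_finsetSum_measure fun k _ => (hk k).1,
    Finset.sum_eq_zero fun k _ => (hk k).2, smul_zero]

/-- **Site-uniform moment bounds pass to the Cesàro averages** (same constant). [folklore] -/
theorem site_moment_cesaro {ν : Measure ChainConfig} [IsProbabilityMeasure ν] {m : ℕ} {C : ℝ}
    (hmom : ∀ x : ℤ, Integrable (fun σ : ChainConfig => |(σ x).1| ^ m + |(σ x).2| ^ m) ν ∧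
      ∫ σ, (|(σ x).1| ^ m + |(σ x).2| ^ m) ∂ν ≤ C) (n : ℕ) (x : ℤ) :
    Integrable (fun σ : ChainConfig => |(σ x).1| ^ m + |(σ x).2| ^ m)
        (((n : ℝ≥0∞) + 1)⁻¹ • ∑ k ∈ Finset.range (n + 1), ν.map (shift^[k])) ∧
      ∫ σ, (|(σ x).1| ^ m + |(σ x).2| ^ m)
        ∂(((n : ℝ≥0∞) + 1)⁻¹ • ∑ k ∈ Finset.range (n + 1), ν.map (shift^[k])) ≤ C := by
  have hf : Measurable fun σ : ChainConfig => |(σ x).1| ^ m + |(σ x).2| ^ m := by fun_prop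
  have hcomp : ∀ k : ℕ, (fun σ : ChainConfig => |(σ x).1| ^ m + |(σ x).2| ^ m) ∘ (shift^[k]) =
      fun σ : ChainConfig => |(σ (x + k)).1| ^ m + |(σ (x + k)).2| ^ m := fun k => by
    funext σ; simp [shift_iterate_apply]
  have hint : ∀ k : ℕ, Integrable ((fun σ : ChainConfig => |(σ x).1| ^ m + |(σ x).2| ^ m) ∘
      (shift^[k])) ν := fun k => by rw [hcomp k]; exact (hmom _).1
  obtain ⟨h1, h2⟩ := integral_cesaro n hf hint
  refine ⟨h1, ?_⟩
  rw [h2]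
  have hle : ∀ k ∈ Finset.range (n + 1),
      ∫ σ, (fun σ : ChainConfig => |(σ x).1| ^ m + |(σ x).2| ^ m) ((shift^[k]) σ) ∂ν ≤ C := by
    intro k _
    have := (hmom (x + k)).2
    simpa [shift_iterate_apply] using this
  calc ((n : ℝ) + 1)⁻¹ * ∑ k ∈ Finset.range (n + 1),
        ∫ σ, (fun σ : ChainConfig => |(σ x).1| ^ m + |(σ x).2| ^ m) ((shift^[k]) σ) ∂ν
      ≤ ((n : ℝ) + 1)⁻¹ * ∑ _k ∈ Finset.range (n + 1), C := by
        gcongr with k hk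
        exact hle k hk
    _ = C := by
        rw [Finset.sum_const, Finset.card_range, nsmul_eq_mul]; push_cast; field_simp

/-- **Almost shift invariance of the Cesàro averages**, tested against a bounded function:
`|∫ f ∘ τ dν_n - ∫ f dν_n| ≤ 2M/(n+1)` for `|f| ≤ M` measurable. [folklore] -/
theorem abs_integral_comp_shift_cesaro_sub_le {ν : Measure ChainConfig} [IsProbabilityMeasure ν]
    (n : ℕ) {f : ChainConfig → ℝ} (hf : Measurable f) {M : ℝ} (hM : ∀ σ, |f σ| ≤ M) :
    |∫ σ, f (shift σ) ∂(((n : ℝ≥0∞) + 1)⁻¹ • ∑ k ∈ Finset.range (n + 1), ν.map (shift^[k])) -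
      ∫ σ, f σ ∂(((n : ℝ≥0∞) + 1)⁻¹ • ∑ k ∈ Finset.range (n + 1), ν.map (shift^[k]))| ≤
      2 * M / ((n : ℝ) + 1) := by
  have hM0 : 0 ≤ M := (abs_nonneg _).trans (hM fun _ => (0, 0))
  have hbint : ∀ (g : ChainConfig → ℝ), Measurable g → (∀ σ, |g σ| ≤ M) → ∀ k : ℕ,
      Integrable (g ∘ shift^[k]) ν := fun g hg hgM k =>
    Integrable.of_bound ((hg.comp (measurable_shift_iterate k)).aestronglyMeasurable) M
      (Eventually.of_forall fun σ => by rw [Real.norm_eq_abs]; exact hgM _)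
  have h1 := (integral_cesaro n (f := fun σ => f (shift σ)) (hf.comp shift_measurable)
    (hbint _ (hf.comp shift_measurable) (fun σ => hM _))).2
  have h2 := (integral_cesaro n hf (hbint _ hf hM)).2
  rw [h1, h2, ← mul_sub, ← Finset.sum_sub_distrib]
  set a : ℕ → ℝ := fun k => ∫ σ, f ((shift^[k]) σ) ∂ν with ha
  have hterm : ∀ k : ℕ, (∫ σ, f (shift ((shift^[k]) σ)) ∂ν) - ∫ σ, f ((shift^[k]) σ) ∂ν =
      a (k + 1) - a k := fun k => by
    simp only [ha, Function.iterate_succ_apply']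
  rw [Finset.sum_congr rfl fun k _ => hterm k, Finset.sum_range_sub, abs_mul,
    abs_of_pos (by positivity : (0 : ℝ) < ((n : ℝ) + 1)⁻¹)]
  have hb : ∀ k : ℕ, |∫ σ, f ((shift^[k]) σ) ∂ν| ≤ M := fun k => by
    refine (abs_integral_le_integral_abs).trans ?_
    calc ∫ σ, |f ((shift^[k]) σ)| ∂ν ≤ ∫ _σ, M ∂ν :=
          integral_mono (hbint _ hf hM k).abs (integrable_const M) fun σ => hM _
      _ = M := by simp
  calc ((n : ℝ) + 1)⁻¹ * |a (n + 1) - a 0|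
      ≤ ((n : ℝ) + 1)⁻¹ * (M + M) := by
        gcongr
        exact (abs_sub _ _).trans (add_le_add (hb (n + 1)) (hb 0))
    _ = 2 * M / ((n : ℝ) + 1) := by ring

/-! ### Tightness from site-uniform second moments -/

/-- Chebyshev at one site: `ρ {r < ‖σ_x‖} ≤ (∫ (q_x² + p_x²) dρ) / r²`. [folklore] -/
theorem measure_norm_apply_gt_le {ρ : Measure ChainConfig} [IsFiniteMeasure ρ] (x : ℤ)
    (hint : Integrable (fun σ : ChainConfig => |(σ x).1| ^ 2 + |(σ x).2| ^ 2) ρ) {r : ℝ} (hr : 0 < r) :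
    ρ {σ | r < ‖σ x‖} ≤ ENNReal.ofReal ((∫ σ, (|(σ x).1| ^ 2 + |(σ x).2| ^ 2) ∂ρ) / r ^ 2) := by
  have hsub : {σ : ChainConfig | r < ‖σ x‖} ⊆ {σ | r ^ 2 ≤ |(σ x).1| ^ 2 + |(σ x).2| ^ 2} := by
    intro σ hσ
    simp only [mem_setOf_eq, Prod.norm_def, Real.norm_eq_abs] at hσ ⊢
    rcases lt_max_iff.mp hσ with h | h
    · nlinarith [sq_nonneg (σ x).2, abs_nonneg (σ x).1]
    · nlinarith [sq_nonneg (σ x).1, abs_nonneg (σ x).2]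
  have hmarkov := mul_meas_ge_le_integral_of_nonneg (μ := ρ)
    (Eventually.of_forall fun σ => by positivity) hint (r ^ 2)
  have hr2 : 0 < r ^ 2 := by positivity
  have hreal : ρ.real {σ | r ^ 2 ≤ |(σ x).1| ^ 2 + |(σ x).2| ^ 2} ≤
      (∫ σ, (|(σ x).1| ^ 2 + |(σ x).2| ^ 2) ∂ρ) / r ^ 2 := by
    rw [le_div_iff₀ hr2, mul_comm]; exact hmarkov
  calc ρ {σ | r < ‖σ x‖} ≤ ρ {σ | r ^ 2 ≤ |(σ x).1| ^ 2 + |(σ x).2| ^ 2} := measure_mono hsub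
    _ = ENNReal.ofReal (ρ.real {σ | r ^ 2 ≤ |(σ x).1| ^ 2 + |(σ x).2| ^ 2}) :=
        (ENNReal.ofReal_toReal (measure_ne_top _ _)).symm
    _ ≤ _ := ENNReal.ofReal_le_ofReal hreal

/-- The weights `2^{-|x|}` are summable over `ℤ`. [folklore] -/
theorem summable_half_pow_natAbs : Summable fun x : ℤ => ((1 : ℝ) / 2) ^ x.natAbs := by
  refine summable_int_iff_summable_nat_and_neg.mpr ⟨?_, ?_⟩
  · simpa using summable_geometric_of_lt_one (by norm_num : (0 : ℝ) ≤ 1 / 2) (by norm_num)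
  · simpa using summable_geometric_of_lt_one (by norm_num : (0 : ℝ) ≤ 1 / 2) (by norm_num)

/-- **Tightness from site-uniform second moments**: a family of probability measures on
`ℤ → ℝ × ℝ` with `∫ (q_x² + p_x²) dρ ≤ C₂` for every site and every member is tight (Tychonoff
boxes `∏_x B(0, r_x)`, `r_x² ∼ 2^{|x|}/ε`, and Chebyshev per site). [folklore] -/
theorem isTightMeasureSet_of_site_sq_moment {S : Set (Measure ChainConfig)} {C₂ : ℝ}
    (hS : ∀ ρ ∈ S, IsProbabilityMeasure ρ ∧ ∀ x : ℤ,
      Integrable (fun σ : ChainConfig => |(σ x).1| ^ 2 + |(σ x).2| ^ 2) ρ ∧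
        ∫ σ, (|(σ x).1| ^ 2 + |(σ x).2| ^ 2) ∂ρ ≤ C₂) :
    IsTightMeasureSet S := by
  rw [isTightMeasureSet_iff_exists_isCompact_measure_compl_le]
  intro ε hε
  rcases eq_top_or_lt_top ε with hεtop | hεtop
  · exact ⟨∅, isCompact_empty, fun ρ _ => hεtop ▸ le_top⟩
  set ε' : ℝ := ε.toReal with hε'
  have hε'pos : 0 < ε' := ENNReal.toReal_pos hε.ne' hεtop.ne
  set B : ℝ := ∑' x : ℤ, ((1 : ℝ) / 2) ^ x.natAbs with hB
  have hBpos : 0 < B := summable_half_pow_natAbs.tsum_pos (fun x => by positivity) 0 (by simp)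
  set C : ℝ := max C₂ 0 + 1 with hC
  have hCpos : 0 < C := by positivity
  -- radii: r_x² = C B 2^{|x|} / ε'
  set r : ℤ → ℝ := fun x => Real.sqrt (C * B * 2 ^ x.natAbs / ε') with hr
  have hr2 : ∀ x, r x ^ 2 = C * B * 2 ^ x.natAbs / ε' := fun x =>
    Real.sq_sqrt (by positivity)
  have hrpos : ∀ x, 0 < r x := fun x => Real.sqrt_pos.mpr (by positivity)
  refine ⟨Set.pi univ fun x => Metric.closedBall (0 : ℝ × ℝ) (r x),
    isCompact_univ_pi fun x => isCompact_closedBall _ _, fun ρ hρ => ?_⟩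
  obtain ⟨hprob, hmom⟩ := hS ρ hρ
  have hcompl : (Set.pi univ fun x => Metric.closedBall (0 : ℝ × ℝ) (r x))ᶜ ⊆
      ⋃ x : ℤ, {σ : ChainConfig | r x < ‖σ x‖} := by
    intro σ hσ
    simp only [mem_compl_iff, mem_univ_pi, Metric.mem_closedBall, dist_zero_right, not_forall,
      not_le] at hσ
    obtain ⟨x, hx⟩ := hσ
    exact mem_iUnion.mpr ⟨x, hx⟩
  have hsite : ∀ x : ℤ, ρ {σ : ChainConfig | r x < ‖σ x‖} ≤
      ENNReal.ofReal (ε' / B * ((1 : ℝ) / 2) ^ x.natAbs) := fun x => by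
    refine (measure_norm_apply_gt_le x (hmom x).1 (hrpos x)).trans (ENNReal.ofReal_le_ofReal ?_)
    rw [hr2 x, div_le_iff₀ (by positivity)]
    have hC2 : ∫ σ, (|(σ x).1| ^ 2 + |(σ x).2| ^ 2) ∂ρ ≤ C := by
      have := (hmom x).2
      have : C₂ ≤ C := by rw [hC]; linarith [le_max_left C₂ 0]
      linarith
    have hRHS : ε' / B * ((1 : ℝ) / 2) ^ x.natAbs * (C * B * 2 ^ x.natAbs / ε') = C := by
      rw [one_div, inv_pow]
      field_simp [hBpos.ne', hε'pos.ne']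
    rw [hRHS]
    exact hC2
  have hw0 : ∀ x : ℤ, 0 ≤ ε' / B * ((1 : ℝ) / 2) ^ x.natAbs := fun x => by positivity
  have hwsum : Summable fun x : ℤ => ε' / B * ((1 : ℝ) / 2) ^ x.natAbs :=
    summable_half_pow_natAbs.mul_left _
  calc ρ (Set.pi univ fun x => Metric.closedBall (0 : ℝ × ℝ) (r x))ᶜ
      ≤ ρ (⋃ x : ℤ, {σ : ChainConfig | r x < ‖σ x‖}) := measure_mono hcompl
    _ ≤ ∑' x : ℤ, ρ {σ : ChainConfig | r x < ‖σ x‖} := measure_iUnion_le _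
    _ ≤ ∑' x : ℤ, ENNReal.ofReal (ε' / B * ((1 : ℝ) / 2) ^ x.natAbs) := ENNReal.tsum_le_tsum hsite
    _ = ENNReal.ofReal (∑' x : ℤ, ε' / B * ((1 : ℝ) / 2) ^ x.natAbs) :=
        (ENNReal.ofReal_tsum_of_nonneg hw0 hwsum).symm
    _ = ENNReal.ofReal ε' := by
        rw [tsum_mul_left, ← hB, div_mul_cancel₀ _ hBpos.ne']
    _ = ε := ENNReal.ofReal_toReal hεtop.ne


/-! ### A shift-invariant weak cluster point (Prokhorov) -/

/-- **A shift-invariant weak cluster point of the Cesàro averages.** For a probability measure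
`ν` with site-uniform second moments, the Cesàro averages `ν_n` (as `ProbabilityMeasure`s)
converge along some ultrafilter finer than `atTop` to a probability measure `ν̄`, and `ν̄` is
shift invariant. (Prokhorov: Mathlib `isCompact_closure_of_isTightMeasureSet`; the cluster point
as an ultrafilter limit, `mapClusterPt_iff_ultrafilter`; invariance by testing against bounded
continuous functions.) [folklore] -/
theorem exists_cesaro_clusterPt (ν : Measure ChainConfig) [IsProbabilityMeasure ν] {C₂ : ℝ}
    (h2 : ∀ x : ℤ, Integrable (fun σ : ChainConfig => |(σ x).1| ^ 2 + |(σ x).2| ^ 2) ν ∧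
      ∫ σ, (|(σ x).1| ^ 2 + |(σ x).2| ^ 2) ∂ν ≤ C₂) :
    ∃ (c : ℕ → ProbabilityMeasure ChainConfig) (ν' : ProbabilityMeasure ChainConfig)
      (U : Ultrafilter ℕ),
      (∀ n, (c n : Measure ChainConfig) =
        ((n : ℝ≥0∞) + 1)⁻¹ • ∑ k ∈ Finset.range (n + 1), ν.map (shift^[k])) ∧
      (↑U : Filter ℕ) ≤ atTop ∧ Tendsto c U (𝓝 ν') ∧
      IsShiftInvariant (ν' : Measure ChainConfig) := by
  let c : ℕ → ProbabilityMeasure ChainConfig := fun n =>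
    ⟨((n : ℝ≥0∞) + 1)⁻¹ • ∑ k ∈ Finset.range (n + 1), ν.map (shift^[k]),
      isProbabilityMeasure_cesaro ν n⟩
  have hc : ∀ n, (c n : Measure ChainConfig) =
      ((n : ℝ≥0∞) + 1)⁻¹ • ∑ k ∈ Finset.range (n + 1), ν.map (shift^[k]) := fun n => rfl
  -- tightness and Prokhorov
  have htight : IsTightMeasureSet
      {((μ : ProbabilityMeasure ChainConfig) : Measure ChainConfig) | μ ∈ Set.range c} := by
    refine isTightMeasureSet_of_site_sq_moment (C₂ := C₂) fun ρ hρ => ?_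
    obtain ⟨μ, ⟨n, rfl⟩, rfl⟩ := hρ
    exact ⟨(c n).prop, fun x => site_moment_cesaro h2 n x⟩
  have hcomp : IsCompact (closure (Set.range c)) := isCompact_closure_of_isTightMeasureSet htight
  have hle : map c atTop ≤ 𝓟 (closure (Set.range c)) :=
    le_principal_iff.mpr (mem_map.mpr (Eventually.of_forall fun n => subset_closure
      (Set.mem_range_self n)))
  obtain ⟨ν', -, hν'⟩ := hcomp.exists_clusterPt hle
  obtain ⟨U, hU, hUt⟩ := mapClusterPt_iff_ultrafilter.mp hν'
  refine ⟨c, ν', U, hc, hU, hUt, ?_⟩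
  -- shift invariance, tested against bounded continuous functions
  have hshiftc : Continuous (shift : ChainConfig → ChainConfig) :=
    continuous_pi fun _ => continuous_apply _
  have key : ∀ φ : ChainConfig →ᵇ ℝ,
      ∫ σ, φ (shift σ) ∂(ν' : Measure ChainConfig) = ∫ σ, φ σ ∂(ν' : Measure ChainConfig) := by
    intro φ
    have hlim := ProbabilityMeasure.tendsto_iff_forall_integral_tendsto.mp hUt
    have h1 : Tendsto (fun n => ∫ σ, φ σ ∂(c n : Measure ChainConfig)) U
        (𝓝 (∫ σ, φ σ ∂(ν' : Measure ChainConfig))) := hlim φ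
    have h2 : Tendsto (fun n => ∫ σ, φ (shift σ) ∂(c n : Measure ChainConfig)) U
        (𝓝 (∫ σ, φ (shift σ) ∂(ν' : Measure ChainConfig))) :=
      hlim (φ.compContinuous ⟨shift, hshiftc⟩)
    have hM : ∀ σ, |φ σ| ≤ ‖φ‖ := fun σ => by
      rw [← Real.norm_eq_abs]; exact φ.norm_coe_le_norm σ
    have h3 : Tendsto (fun n : ℕ => 2 * ‖φ‖ / ((n : ℝ) + 1)) atTop (𝓝 0) :=
      tendsto_const_nhds.div_atTop (tendsto_natCast_atTop_atTop.atTop_add tendsto_const_nhds)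
    have h4 : Tendsto (fun n => ∫ σ, φ (shift σ) ∂(c n : Measure ChainConfig) -
        ∫ σ, φ σ ∂(c n : Measure ChainConfig)) U (𝓝 0) := by
      refine squeeze_zero_norm' (Eventually.of_forall fun n => ?_) (h3.mono_left hU)
      rw [Real.norm_eq_abs, hc n]
      exact abs_integral_comp_shift_cesaro_sub_le n φ.continuous.measurable hM
    have h5 : Tendsto (fun n => ∫ σ, φ (shift σ) ∂(c n : Measure ChainConfig)) U
        (𝓝 (∫ σ, φ σ ∂(ν' : Measure ChainConfig))) := by
      have := h1.add h4
      simp only [add_zero, add_sub_cancel] at this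
      exact this
    exact tendsto_nhds_unique h2 h5
  -- conclude with `FiniteMeasure.ext_of_forall_integral_eq`
  have hext : (ν'.map shift_measurable.aemeasurable).toFiniteMeasure = ν'.toFiniteMeasure := by
    refine FiniteMeasure.ext_of_forall_integral_eq fun φ => ?_
    change ∫ σ, φ σ ∂((ν'.map shift_measurable.aemeasurable : ProbabilityMeasure ChainConfig) :
      Measure ChainConfig) = ∫ σ, φ σ ∂(ν' : Measure ChainConfig)
    rw [ProbabilityMeasure.toMeasure_map,
      integral_map shift_measurable.aemeasurable φ.continuous.aestronglyMeasurable]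
    exact key φ
  have := congrArg (fun μ : FiniteMeasure ChainConfig => (μ : Measure ChainConfig)) hext
  simpa [IsShiftInvariant] using this

end Summit.AtomisticToContinuum.FouriersLaw.Theorems.CesaroUpgrade

end
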